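import Literature.NumberTheory.Automorphic.PretraceApproxIdentity
import Literature.NumberTheory.Automorphic.SpectralTestFunctions

/-!
# The approximate identity `G_w^δ = (8πδ)⁻¹ K_δ(·, w)` in `L²(Γ\ℍ)`
(Iwaniec, *Spectral Methods of Automorphic Forms*, GSM 53, proof of Theorem 7.4 ("one can show
quite easily using only the spectral decomposition of a `⟨K(·,w), u⟩`" — the pretrace formula is
obtained by pairing with eigenfunctions and with an approximate identity), PDF p. 75; proof of
Proposition 7.2, PDF p. 73)

A brick of the Eisenstein-free proof of the pretrace estimate (12.5)
(`Literature.NumberTheory.Automorphic.Iwaniec2002_eq_12_5`). For a finite-volume group `Γ`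
(matrices, `-1 ∈ Γ`) with fundamental domain `F`, the vectors
`G_w^δ = (8πδ)⁻¹ [K_δ(·, w)] ∈ L²(F)`, `K_δ` the automorphic kernel (over matrices) of `𝟙_{[0,δ]}`,
form an approximate identity at the orbit of `w`:

1. (§1) `G_w^δ` and its representative; `K_k(·, w) ∈ L²(F)` for every test kernel `k`.
2. (§2) **the kernel operators on `G_w^δ`, unfolded**:
   `(T_{k'} G_w^δ)(v) = (8πδ)⁻¹ ∫_ℍ 𝟙_{u(w,v') ≤ δ} K_{k'}(v, v') dμ(v')` (`kernelOp_ballFun`), and the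
   resulting bound **`‖T_{k'} G_w^δ‖² ≤ B/4`** whenever `∫_F K_{k'}(·, v')² ≤ B` on the ball
   `u(w, v') ≤ δ` (`norm_sq_kernelCLM_ballVec_le`, Jensen and Tonelli) — with the tent kernels
   `k' = k_{δ_m}` and `B = 8π δ_m N` this is the local Weyl input of the proof of (12.5).
3. (§3) **the spectral coefficients** `⟨[u], G_w^δ⟩ = (4πδ)⁻¹ h_δ(t) ū(w) → ū(w)` for an
   automorphic eigenfunction `u` (Theorem 1.16 by unfolding, and `h_δ(t)/(4πδ) → 1`), and
   **the geometric limits** `⟨G_z^δ, [Φ]⟩ → Φ(z)` for continuous automorphic `Φ ∈ L²(F)` and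
   `T_k G_w^{δ} → ½ [K_k(·, w)]` in `L²(F)` as `δ → 0⁺`.

Everything here is proved; nothing is vendored; no fact is introduced.

## References
* [Iwaniec2002] H. Iwaniec, *Spectral Methods of Automorphic Forms*, 2nd ed., GSM 53, AMS 2002,
  proof of Prop. 7.2, PDF p. 73; Thm 7.4, PDF p. 75
  (held copy `book:iwaniec2002-spectral-methods-automorphic-forms`).
-/

noncomputable section

namespace Literature.NumberTheory.Automorphic

open _root_.MeasureTheory _root_.Set _root_.Filter _root_.Real UpperHalfPlane
open scoped _root_.Topology _root_.NNReal _root_.ENNReal _root_.ComplexConjugate MatrixGroups _root_.InnerProductSpace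

variable {Γ : Subgroup (GL (Fin 2) ℝ)} {F : Set ℍ} {k : ℝ → ℝ}

/-! ## 1. The vectors `G_w^δ` -/

section Vectors

variable (hΓ : Γ ≤ (Matrix.SpecialLinearGroup.toGL : SL(2, ℝ) →* GL (Fin 2) ℝ).range)
  (hneg : (-1 : GL (Fin 2) ℝ) ∈ Γ) (hd : IsDiscreteSubgroup Γ) (hF : IsHypFundamentalDomain Γ F)

/-- The function `G_w^δ(v) = (8πδ)⁻¹ K_δ(v, w)` (`K_δ` the automorphic kernel over matrices of
`𝟙_{[0,δ]}`; total mass `∫_F G_w^δ dμ = 1`). [cite: Iwaniec2002, proof of Prop. 7.2 & Thm 7.4, PDF pp. 73, 75] -/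
def ballFun (Γ : Subgroup (GL (Fin 2) ℝ)) (δ : ℝ) (w : ℍ) (v : ℍ) : ℂ :=
  (((8 * π * δ)⁻¹ : ℝ) : ℂ) * (automorphicKernel Γ (ballKernel δ) v w : ℂ)

/-- **The approximate identity `G_w^δ ∈ L²(F)`** (for `δ > 0`; the junk value `0` otherwise, so that
limits `δ → 0⁺` can be taken along `𝓝[>] 0`). [cite: Iwaniec2002, proof of Prop. 7.2 & Thm 7.4, PDF pp. 73, 75] -/
def ballVec (δ : ℝ) (w : ℍ) : Lp ℂ 2 ((volume : Measure ℍ).restrict F) :=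
  if hδ : 0 < δ then
    (((8 * π * δ)⁻¹ : ℝ) : ℂ) • (memLp_automorphicKernel_ballKernel hΓ hneg hd hF hδ.le w).1.toLp _
  else 0

/-- The representative of `G_w^δ`. [folklore] -/
theorem ballVec_coeFn {δ : ℝ} (hδ : 0 < δ) (w : ℍ) :
    ⇑(ballVec hΓ hneg hd hF δ w) =ᵐ[volume.restrict F] ballFun Γ δ w := by
  unfold ballVec ballFun
  rw [dif_pos hδ]
  filter_upwards [Lp.coeFn_smul ((((8 * π * δ)⁻¹ : ℝ) : ℂ))
      ((memLp_automorphicKernel_ballKernel hΓ hneg hd hF hδ.le w).1.toLp _),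
    (memLp_automorphicKernel_ballKernel hΓ hneg hd hF hδ.le w).1.coeFn_toLp] with v hv hv'
  rw [hv, Pi.smul_apply, hv', smul_eq_mul]

include hΓ hd in
/-- `|K_k(v, w)| ≤ B · K^{ball}_M(v, w)` for a test kernel with `|k| ≤ B`, `k = 0` on `[M, ∞)`. [folklore] -/
theorem abs_automorphicKernel_le_ballKernel {B M : ℝ} (hB : ∀ u, |k u| ≤ B)
    (hM : ∀ u, M ≤ u → k u = 0) (v w : ℍ) :
    |automorphicKernel Γ k v w| ≤ B * automorphicKernel Γ (ballKernel M) v w := by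
  have hMb : ∀ u, M + 1 ≤ u → ballKernel M u = 0 := fun u hu => ballKernel_of_gt (by linarith)
  have hS := finite_hypBall hΓ hd v w (M + 1)
  rw [automorphicKernel_eq_sum hM v w hS (fun γ hγ => hγ.1) (fun γ hγ hlt => ⟨hγ, by linarith⟩),
    automorphicKernel_eq_sum hMb v w hS (fun γ hγ => hγ.1) (fun γ hγ hlt => ⟨hγ, hlt.le⟩), Finset.mul_sum]
  refine (Finset.abs_sum_le_sum_abs _ _).trans (Finset.sum_le_sum fun γ _ => ?_)
  by_cases hu : pointPairInv (γ • v) w ≤ M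
  · rw [ballKernel_of_le hu, mul_one]; exact hB _
  · rw [hM _ (not_le.mp hu).le, abs_zero, ballKernel_of_gt (not_le.mp hu), mul_zero]

include hΓ hneg hd hF in
/-- **`K_k(·, w) ∈ L²(F)`** for every test kernel `k` (domination by `‖k‖_∞ K^{ball}_M(·, w)`). [cite: Iwaniec2002, §7.2 (7.8), PDF p. 72] -/
theorem memLp_automorphicKernel (hk : IsTestKernel k) (hkc : Continuous k) (w : ℍ) :
    MemLp (fun v : ℍ => (automorphicKernel Γ k v w : ℂ)) 2 (volume.restrict F) := by
  obtain ⟨_, ⟨B, hB⟩, ⟨M, hM0, hM⟩⟩ := id hk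
  have hB0 : 0 ≤ B := (abs_nonneg _).trans (hB 0)
  refine MemLp.of_le_mul (c := B) (memLp_automorphicKernel_ballKernel hΓ hneg hd hF hM0 w).1
    (Complex.continuous_ofReal.comp (continuous_automorphicKernel_left hΓ hd hk hkc w)).aestronglyMeasurable
    (Eventually.of_forall fun v => ?_)
  rw [Complex.norm_real, Complex.norm_real, Real.norm_eq_abs, Real.norm_eq_abs,
    abs_of_nonneg (automorphicKernel_ballKernel_nonneg hΓ hd v w)]
  exact abs_automorphicKernel_le_ballKernel hΓ hd hB hM v w

end Vectors

/-! ## 2. The kernel operators on `G_w^δ` -/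

section Operators

variable (hΓ : Γ ≤ (Matrix.SpecialLinearGroup.toGL : SL(2, ℝ) →* GL (Fin 2) ℝ).range)
  (hneg : (-1 : GL (Fin 2) ℝ) ∈ Γ) (hd : IsDiscreteSubgroup Γ) (hF : IsHypFundamentalDomain Γ F)

include hΓ hd in
/-- The automorphic kernel is automorphic in the second variable: `K(z, γ w) = K(z, w)`. [folklore] -/
theorem automorphicKernel_smul_right {M : ℝ} (hM : ∀ u, M ≤ u → k u = 0) {γ₀ : GL (Fin 2) ℝ} (hγ₀ : γ₀ ∈ Γ)
    (z w : ℍ) : automorphicKernel Γ k z (γ₀ • w) = automorphicKernel Γ k z w := by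
  rw [automorphicKernel_comm hΓ hd hM z (γ₀ • w), automorphicKernel_smul_left hΓ hd hM hγ₀,
    automorphicKernel_comm hΓ hd hM w z]

include hΓ hneg hd hF in
/-- **The kernel operators on `G_w^δ`, unfolded**: for a continuous test kernel `k'` and every `v ∈ ℍ`,
`(T_{k'} G_w^δ)(v) = (8πδ)⁻¹ ∫_ℍ 𝟙_{u(w,v') ≤ δ} K_{k'}(v, v') dμ(v')`
(`∫_F K_{k'}(v, v') K_δ(v', w) dμ(v') = 2 ∫_ℍ 𝟙_{u(w,v') ≤ δ} K_{k'}(v, v') dμ(v')` by unfolding the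
kernel `K_δ(v', w) = K_δ(w, v')` against the automorphic function `K_{k'}(v, ·)`). [cite: Iwaniec2002, Thm 7.4 (proof), PDF p. 75] -/
theorem kernelOp_ballFun {k' : ℝ → ℝ} (hk' : IsTestKernel k') (hk'c : Continuous k') {δ : ℝ} (hδ : 0 < δ)
    (w v : ℍ) :
    kernelOp Γ F k' (ballFun Γ δ w) v =
      (((8 * π * δ)⁻¹ : ℝ) : ℂ) * ∫ v' : ℍ, (ballKernel δ (pointPairInv w v') : ℂ) * (automorphicKernel Γ k' v v' : ℂ) := by
  obtain ⟨_, _, ⟨M', _, hM'⟩⟩ := id hk'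
  have hMb : ∀ u, δ + 1 ≤ u → ballKernel δ u = 0 := fun u hu => ballKernel_of_gt (by linarith)
  rw [kernelOp_apply]
  unfold ballFun
  have e1 : ∫ v' in F, (automorphicKernel Γ k' v v' : ℂ) *
      ((((8 * π * δ)⁻¹ : ℝ) : ℂ) * (automorphicKernel Γ (ballKernel δ) v' w : ℂ)) =
      (((8 * π * δ)⁻¹ : ℝ) : ℂ) * ∫ v' in F, (automorphicKernel Γ (ballKernel δ) w v' : ℂ) * (automorphicKernel Γ k' v v' : ℂ) := by
    rw [← integral_const_mul]
    refine setIntegral_congr_fun hF.measurableSet fun v' _ => ?_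
    rw [automorphicKernel_comm hΓ hd hMb v' w]; ring
  have hfa : IsAutomorphic Γ fun v' => (automorphicKernel Γ k' v v' : ℂ) := by
    intro γ hγ v'
    simp only
    rw [automorphicKernel_smul_right hΓ hd hM' hγ]
  have hfi : LocallyIntegrable fun v' => (automorphicKernel Γ k' v v' : ℂ) :=
    (Complex.continuous_ofReal.comp (continuous_automorphicKernel_right hΓ hd hk' hk'c v)).locallyIntegrable
  rw [e1, setIntegral_automorphicKernel_mul hΓ hneg hd hF (isTestKernel_ballKernel hδ.le) hfa hfi w,
    invariantOperator_apply]
  ring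

include hΓ hneg hd hF in
/-- The representative of `T_{k'} G_w^δ`. [folklore] -/
theorem kernelCLM_ballVec_coeFn {k' : ℝ → ℝ} (hk' : IsTestKernel k') (hk'c : Continuous k') {δ : ℝ} (hδ : 0 < δ)
    (w : ℍ) :
    ⇑(kernelCLM hΓ hneg hd hF hk' hk'c (ballVec hΓ hneg hd hF δ w)) =ᵐ[volume.restrict F] fun v =>
      (((8 * π * δ)⁻¹ : ℝ) : ℂ) * ∫ v' : ℍ, (ballKernel δ (pointPairInv w v') : ℂ) * (automorphicKernel Γ k' v v' : ℂ) := by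
  filter_upwards [kernelCLM_coeFn hΓ hneg hd hF hk' hk'c (ballVec hΓ hneg hd hF δ w)] with v hv
  rw [hv, congrFun (kernelOp_congr_ae (ballVec_coeFn hΓ hneg hd hF hδ w)) v, kernelOp_ballFun hΓ hneg hd hF hk' hk'c hδ]

/-- **Jensen / Cauchy–Schwarz for a sub-probability weight**: for `0 ≤ b ≤ 1`-valued... precisely for
real functions with `b ≥ 0` and `b K`, `b K²`, `b` integrable: `(∫ b K)² ≤ (∫ b) (∫ b K²)`
(non-negativity of `∫ b (K - x)²` for all `x` and the discriminant). [folklore] -/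
theorem sq_integral_mul_le {X : Type*} [MeasurableSpace X] {μ : Measure X} {b K : X → ℝ}
    (hb0 : ∀ x, 0 ≤ b x) (hb : Integrable b μ) (hbK : Integrable (fun x => b x * K x) μ)
    (hbK2 : Integrable (fun x => b x * K x ^ 2) μ) :
    (∫ x, b x * K x ∂μ) ^ 2 ≤ (∫ x, b x ∂μ) * ∫ x, b x * K x ^ 2 ∂μ := by
  have hq : ∀ y : ℝ, 0 ≤ (∫ x, b x ∂μ) * (y * y) + (-2 * ∫ x, b x * K x ∂μ) * y + ∫ x, b x * K x ^ 2 ∂μ := by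
    intro y
    have e : (∫ x, b x ∂μ) * (y * y) + (-2 * ∫ x, b x * K x ∂μ) * y + ∫ x, b x * K x ^ 2 ∂μ =
        ∫ x, b x * (K x - y) ^ 2 ∂μ := by
      have h1 : ∫ x, b x * (K x - y) ^ 2 ∂μ = ∫ x, (b x * K x ^ 2 - (2 * y) * (b x * K x) + y ^ 2 * b x) ∂μ := by
        congr 1 with x; ring
      have h2 : ∫ x, (b x * K x ^ 2 - (2 * y) * (b x * K x) + y ^ 2 * b x) ∂μ =
          (∫ x, b x * K x ^ 2 ∂μ) - (2 * y) * (∫ x, b x * K x ∂μ) + y ^ 2 * ∫ x, b x ∂μ := by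
        rw [integral_add (hbK2.sub' (hbK.const_mul _)) (hb.const_mul _), integral_sub hbK2 (hbK.const_mul _),
          integral_const_mul, integral_const_mul]
      rw [h1, h2]
      ring
    rw [e]
    exact integral_nonneg fun x => mul_nonneg (hb0 x) (sq_nonneg _)
  have hdisc := discrim_le_zero hq
  rw [discrim] at hdisc
  nlinarith [hdisc]

include hΓ hneg hd hF in
/-- **`‖T_{k'} G_w^δ‖² ≤ B/4`** for a non-negative continuous test kernel `k'` whenever
`∫_F K_{k'}(v, v')² dμ(v) ≤ B` for all `v'` in the ball `u(w, v') ≤ δ`: by Jensen,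
`|(T_{k'} G_w^δ)(v)|² ≤ (8πδ)⁻² · 4πδ · ∫_ℍ 𝟙_{u(w,v') ≤ δ} K_{k'}(v, v')² dμ(v')`, and by Tonelli
the `F`-integral is at most `(8πδ)⁻² (4πδ)² B`. With the kernels of Proposition 7.2 this is the local
Weyl bound `≪ δ_m N_{δ_m}(w)` uniformly in the radius `δ`. [cite: Iwaniec2002, proof of Prop. 7.2, PDF p. 73] -/
theorem norm_sq_kernelCLM_ballVec_le {k' : ℝ → ℝ} (hk' : IsTestKernel k') (hk'c : Continuous k')
    (hk'0 : ∀ u, 0 ≤ k' u) {δ : ℝ} (hδ : 0 < δ) (w : ℍ) {B : ℝ≥0∞} (hB : B ≠ ⊤)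
    (hbound : ∀ v', pointPairInv w v' ≤ δ →
      ∫⁻ v in F, ENNReal.ofReal (automorphicKernel Γ k' v v' ^ 2) ≤ B) :
    ‖kernelCLM hΓ hneg hd hF hk' hk'c (ballVec hΓ hneg hd hF δ w)‖ ^ 2 ≤ B.toReal / 4 := by
  obtain ⟨_, _, ⟨M', _, hM'⟩⟩ := id hk'
  have hkb := isTestKernel_ballKernel hδ.le
  set c : ℝ := (8 * π * δ)⁻¹ with hc
  have hc0 : 0 < c := by rw [hc]; positivity
  -- notation
  set b : ℍ → ℝ := fun v' => ballKernel δ (pointPairInv w v') with hb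
  set Kr : ℍ → ℍ → ℝ := fun v v' => automorphicKernel Γ k' v v' with hKr
  have hb0 : ∀ v', 0 ≤ b v' := fun v' => ballKernel_nonneg δ _
  have hb1 : ∀ v', b v' ≤ 1 := fun v' => ballKernel_le_one δ _
  have hKr0 : ∀ v v', 0 ≤ Kr v v' := by
    intro v v'
    simp only [hKr]
    rw [← tsum_kernel_eq_automorphicKernel hΓ hd hM' v v']
    exact tsum_nonneg fun γ => hk'0 _
  have hKc : Continuous (Function.uncurry Kr) := continuous_automorphicKernel₂ hΓ hd hk' hk'c
  have hbm : Measurable b := (measurable_ballKernel δ).comp (continuous_pointPairInv w).measurable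
  -- integrability of `b · f` for continuous non-negative `f`
  have hint : ∀ {f : ℍ → ℝ}, Continuous f → (∀ v', 0 ≤ f v') → Integrable fun v' => b v' * f v' := by
    intro f hf hf0
    have h := (integrable_kernel_mul_of_continuous hkb (Complex.continuous_ofReal.comp hf) w).norm
    refine h.congr (Eventually.of_forall fun v' => ?_)
    simp only [hb, Function.comp_apply, norm_mul, Complex.norm_real, Real.norm_eq_abs,
      abs_of_nonneg (ballKernel_nonneg _ _), abs_of_nonneg (hf0 v')]
  have hbint : Integrable b := by simpa using hint continuous_const (fun _ => zero_le_one)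
  have hbvol : ∫ v', b v' = 4 * π * δ := integral_ballKernel_pointPairInv hδ.le w
  -- Jensen at each `v`
  have hJ : ∀ v, (c * ∫ v', b v' * Kr v v') ^ 2 ≤ c ^ 2 * (4 * π * δ) * ∫ v', b v' * Kr v v' ^ 2 := by
    intro v
    have hKv : Continuous (Kr v) := continuous_automorphicKernel_right hΓ hd hk' hk'c v
    have h := sq_integral_mul_le hb0 hbint (hint hKv (hKr0 v)) (hint (hKv.pow 2) fun v' => sq_nonneg _)
    rw [hbvol] at h
    calc (c * ∫ v', b v' * Kr v v') ^ 2 = c ^ 2 * (∫ v', b v' * Kr v v') ^ 2 := by ring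
      _ ≤ c ^ 2 * ((4 * π * δ) * ∫ v', b v' * Kr v v' ^ 2) := by gcongr
      _ = c ^ 2 * (4 * π * δ) * ∫ v', b v' * Kr v v' ^ 2 := by ring
  -- the representative of `T G`
  set TG := kernelCLM hΓ hneg hd hF hk' hk'c (ballVec hΓ hneg hd hF δ w) with hTG
  have hrep : ∀ᵐ v ∂(volume.restrict F), ‖TG v‖ₑ ^ 2 = ENNReal.ofReal ((c * ∫ v', b v' * Kr v v') ^ 2) := by
    filter_upwards [kernelCLM_ballVec_coeFn hΓ hneg hd hF hk' hk'c hδ w] with v hv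
    rw [hv]
    have e : (((8 * π * δ)⁻¹ : ℝ) : ℂ) * ∫ v' : ℍ, (ballKernel δ (pointPairInv w v') : ℂ) * (automorphicKernel Γ k' v v' : ℂ) =
        ((c * ∫ v', b v' * Kr v v' : ℝ) : ℂ) := by
      rw [hc]
      push_cast
      rw [← integral_complex_ofReal]
      congr 1
      refine integral_congr_ae (Eventually.of_forall fun v' => ?_)
      simp only [hb, hKr]
      push_cast
      ring
    rw [e, ← ofReal_norm, Complex.norm_real, Real.norm_eq_abs, ← ENNReal.ofReal_pow (abs_nonneg _), sq_abs]
  -- `‖TG‖² = ∫⁻ ‖TG‖ₑ²`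
  have hnorm : ‖TG‖ ^ 2 = (∫⁻ v in F, ‖TG v‖ₑ ^ 2).toReal := by
    rw [Lp.norm_def, eLpNorm_eq_lintegral_rpow_enorm_toReal two_ne_zero ENNReal.ofNat_ne_top]
    simp only [ENNReal.toReal_ofNat, one_div]
    rw [← ENNReal.toReal_pow, ← ENNReal.rpow_natCast, ← ENNReal.rpow_mul]
    norm_num
  rw [hnorm]
  -- the chain of Lebesgue integrals
  have hB4 : B.toReal / 4 = (ENNReal.ofReal (c ^ 2 * (4 * π * δ)) * (B * ENNReal.ofReal (4 * π * δ))).toReal := by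
    rw [ENNReal.toReal_mul, ENNReal.toReal_mul, ENNReal.toReal_ofReal (by positivity),
      ENNReal.toReal_ofReal (by positivity), hc]
    field_simp
    ring
  rw [hB4]
  refine ENNReal.toReal_mono (ENNReal.mul_ne_top ENNReal.ofReal_ne_top (ENNReal.mul_ne_top hB ENNReal.ofReal_ne_top)) ?_
  calc ∫⁻ v in F, ‖TG v‖ₑ ^ 2 = ∫⁻ v in F, ENNReal.ofReal ((c * ∫ v', b v' * Kr v v') ^ 2) := lintegral_congr_ae hrep
    _ ≤ ∫⁻ v in F, ENNReal.ofReal (c ^ 2 * (4 * π * δ)) * ∫⁻ v', ENNReal.ofReal (b v') * ENNReal.ofReal (Kr v v' ^ 2) := by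
        refine lintegral_mono fun v => ?_
        refine (ENNReal.ofReal_le_ofReal (hJ v)).trans (le_of_eq ?_)
        have hKv : Continuous (Kr v) := continuous_automorphicKernel_right hΓ hd hk' hk'c v
        have hI2 : Integrable (fun v' => b v' * Kr v v' ^ 2) := hint (f := fun v' => Kr v v' ^ 2) (hKv.pow 2) fun v' => sq_nonneg _
        rw [ENNReal.ofReal_mul (by positivity), ofReal_integral_eq_lintegral_ofReal hI2
          (Eventually.of_forall fun v' => mul_nonneg (hb0 v') (sq_nonneg _))]
        congr 1
        refine lintegral_congr fun v' => ?_
        rw [ENNReal.ofReal_mul (hb0 v')]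
    _ = ENNReal.ofReal (c ^ 2 * (4 * π * δ)) * ∫⁻ v in F, ∫⁻ v', ENNReal.ofReal (b v') * ENNReal.ofReal (Kr v v' ^ 2) := by
        rw [lintegral_const_mul']
        exact ENNReal.ofReal_ne_top
    _ = ENNReal.ofReal (c ^ 2 * (4 * π * δ)) * ∫⁻ v', ∫⁻ v in F, ENNReal.ofReal (b v') * ENNReal.ofReal (Kr v v' ^ 2) := by
        congr 1
        refine lintegral_lintegral_swap ?_
        refine Measurable.aemeasurable ?_
        exact ((ENNReal.measurable_ofReal.comp (hbm.comp measurable_snd))).mul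
          (ENNReal.measurable_ofReal.comp ((hKc.measurable).pow_const 2))
    _ ≤ ENNReal.ofReal (c ^ 2 * (4 * π * δ)) * ∫⁻ v', ENNReal.ofReal (b v') * B := by
        gcongr with v'
        rw [lintegral_const_mul' _ _ ENNReal.ofReal_ne_top]
        by_cases hv' : pointPairInv w v' ≤ δ
        · exact mul_le_mul' le_rfl (hbound v' hv')
        · simp [hb, ballKernel_of_gt (not_le.mp hv')]
    _ = ENNReal.ofReal (c ^ 2 * (4 * π * δ)) * (B * ENNReal.ofReal (4 * π * δ)) := by
        rw [lintegral_mul_const _ hbm.ennreal_ofReal, mul_comm (∫⁻ v', ENNReal.ofReal (b v')) B,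
          ← ofReal_integral_eq_lintegral_ofReal hbint (Eventually.of_forall hb0), hbvol]

end Operators

/-! ## 3. Spectral coefficients and geometric limits -/

section Limits

variable (hΓ : Γ ≤ (Matrix.SpecialLinearGroup.toGL : SL(2, ℝ) →* GL (Fin 2) ℝ).range)
  (hneg : (-1 : GL (Fin 2) ℝ) ∈ Γ) (hd : IsDiscreteSubgroup Γ) (hF : IsHypFundamentalDomain Γ F)

include hΓ hneg hd hF in
/-- **The spectral coefficients of `G_w^δ`**: for an automorphic `C²` eigenfunction `u ∈ L²(F)` with
real eigenvalue `l = 1/4 + t²`, `⟨[u], G_w^δ⟩ = (8πδ)⁻¹ · 2 h_δ(t) ū(w)` (Theorem 1.16 by unfolding,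
`∫_F K_δ(v, w) ū(v) dμ(v) = 2 h_δ(t) ū(w)`). [cite: Iwaniec2002, §7.2 (proof of (7.9)) & Thm 7.4, PDF pp. 72, 75] -/
theorem inner_toLp_ballVec {u : ℍ → ℂ} (hua : IsAutomorphic Γ u) (huc : IsC2 u) {l : ℝ}
    (heig : ∀ z, hypLaplacian u z + l * u z = 0) {t : ℂ} (ht : (1 / 4 : ℂ) + t ^ 2 = l)
    (hu2 : MemLp u 2 (volume.restrict F)) {δ : ℝ} (hδ : 0 < δ) (w : ℍ) :
    ⟪hu2.toLp u, ballVec hΓ hneg hd hF δ w⟫_ℂ =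
      (((8 * π * δ)⁻¹ : ℝ) : ℂ) * (2 * selbergTransform (ballKernel δ) t * conj (u w)) := by
  have hMb : ∀ u, δ + 1 ≤ u → ballKernel δ u = 0 := fun u hu => ballKernel_of_gt (by linarith)
  rw [L2.inner_def]
  have e1 : ∫ v, ⟪(hu2.toLp u : ℍ → ℂ) v, (ballVec hΓ hneg hd hF δ w : ℍ → ℂ) v⟫_ℂ ∂(volume.restrict F) =
      ∫ v in F, (((8 * π * δ)⁻¹ : ℝ) : ℂ) * ((automorphicKernel Γ (ballKernel δ) w v : ℂ) * conj (u v)) := by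
    refine integral_congr_ae ?_
    filter_upwards [hu2.coeFn_toLp, ballVec_coeFn hΓ hneg hd hF hδ w] with v hv hv'
    rw [hv, hv', RCLike.inner_apply, ballFun, automorphicKernel_comm hΓ hd hMb v w]
    simp only [starRingEnd_apply]
    ring
  rw [e1, integral_const_mul, setIntegral_automorphicKernel_mul_eigenfunction hΓ hneg hd hF
    (isTestKernel_ballKernel hδ.le) hua.conj huc.conj t (eigen_conj_of_real heig ht) w]

include hΓ hneg hd hF in
/-- **`⟨[u], G_w^δ⟩ → ū(w)` as `δ → 0⁺`** (`h_δ(t)/(4πδ) → 1`). [cite: Iwaniec2002, proof of Prop. 7.2 & Thm 7.4, PDF pp. 73, 75] -/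
theorem tendsto_inner_toLp_ballVec {u : ℍ → ℂ} (hua : IsAutomorphic Γ u) (huc : IsC2 u) {l : ℝ}
    (heig : ∀ z, hypLaplacian u z + l * u z = 0) {t : ℂ} (ht : (1 / 4 : ℂ) + t ^ 2 = l)
    (hu2 : MemLp u 2 (volume.restrict F)) (w : ℍ) :
    Tendsto (fun δ : ℝ => ⟪hu2.toLp u, ballVec hΓ hneg hd hF δ w⟫_ℂ) (𝓝[>] 0) (𝓝 (conj (u w))) := by
  have hlim := (tendsto_selbergTransform_ballKernel_div t).mul_const (conj (u w))
  rw [one_mul] at hlim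
  refine hlim.congr' ?_
  filter_upwards [self_mem_nhdsWithin] with δ hδ
  have hδ' : (0 : ℝ) < δ := hδ
  rw [inner_toLp_ballVec hΓ hneg hd hF hua huc heig ht hu2 hδ' w]
  have hπ : (π : ℂ) ≠ 0 := by exact_mod_cast Real.pi_ne_zero
  have hδ0 : (δ : ℂ) ≠ 0 := by exact_mod_cast hδ'.ne'
  push_cast
  field_simp
  ring

include hΓ hneg hd hF in
/-- **`⟨G_z^δ, [Φ]⟩ → Φ(z)` as `δ → 0⁺`** for a continuous automorphic `Φ ∈ L²(F)`
(`⟨G_z^δ, [Φ]⟩ = (4πδ)⁻¹ ∫_ℍ 𝟙_{u(z,v) ≤ δ} Φ(v) dμ(v)` by unfolding, and the approximate identity).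
[cite: Iwaniec2002, Thm 7.4 (proof), PDF p. 75] -/
theorem tendsto_inner_ballVec_toLp {Φ : ℍ → ℂ} (hΦa : IsAutomorphic Γ Φ) (hΦc : Continuous Φ)
    (hΦ2 : MemLp Φ 2 (volume.restrict F)) (z : ℍ) :
    Tendsto (fun δ : ℝ => ⟪ballVec hΓ hneg hd hF δ z, hΦ2.toLp Φ⟫_ℂ) (𝓝[>] 0) (𝓝 (Φ z)) := by
  have hlim := tendsto_invariantOperator_ballKernel_div hΦc.locallyIntegrable (z := z) hΦc.continuousAt
  refine hlim.congr' ?_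
  filter_upwards [self_mem_nhdsWithin] with δ hδ
  have hδ' : (0 : ℝ) < δ := hδ
  rw [L2.inner_def]
  have e1 : ∫ v, ⟪(ballVec hΓ hneg hd hF δ z : ℍ → ℂ) v, (hΦ2.toLp Φ : ℍ → ℂ) v⟫_ℂ ∂(volume.restrict F) =
      ∫ v in F, (((8 * π * δ)⁻¹ : ℝ) : ℂ) * ((automorphicKernel Γ (ballKernel δ) z v : ℂ) * Φ v) := by
    refine integral_congr_ae ?_
    have hMb : ∀ u, δ + 1 ≤ u → ballKernel δ u = 0 := fun u hu => ballKernel_of_gt (by linarith)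
    filter_upwards [hΦ2.coeFn_toLp, ballVec_coeFn hΓ hneg hd hF hδ' z] with v hv hv'
    rw [hv, hv', RCLike.inner_apply, ballFun, automorphicKernel_comm hΓ hd hMb v z]
    simp only [map_mul, Complex.conj_ofReal]
    ring
  rw [e1, integral_const_mul, setIntegral_automorphicKernel_mul hΓ hneg hd hF (isTestKernel_ballKernel hδ'.le)
    hΦa hΦc.locallyIntegrable z]
  have hπ : (π : ℂ) ≠ 0 := by exact_mod_cast Real.pi_ne_zero
  have hδ0 : (δ : ℂ) ≠ 0 := by exact_mod_cast hδ'.ne'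
  push_cast
  field_simp
  ring

include hΓ hd in
/-- Comparison of ball counts: for `ρ(v', w) ≤ 1`, `K^{ball}_M(v, v') ≤ K^{ball}_{δ''}(v, w)` with
`δ'' = sinh²(arsinh √(M+1) + ½)` (triangle inequality). [folklore] -/
theorem automorphicKernel_ballKernel_le_of_dist_le {M : ℝ} {v' w : ℍ} (h : dist v' w ≤ 1) (v : ℍ) :
    automorphicKernel Γ (ballKernel M) v v' ≤
      automorphicKernel Γ (ballKernel (Real.sinh ((2 * Real.arsinh (Real.sqrt (M + 1)) + 1) / 2) ^ 2)) v w := by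
  set δ'' : ℝ := Real.sinh ((2 * Real.arsinh (Real.sqrt (M + 1)) + 1) / 2) ^ 2 with hδ''
  have hMb : ∀ u, M + 1 ≤ u → ballKernel M u = 0 := fun u hu => ballKernel_of_gt (by linarith)
  have hMb'' : ∀ u, δ'' + 1 ≤ u → ballKernel δ'' u = 0 := fun u hu => ballKernel_of_gt (by linarith)
  have hS := finite_hypBall hΓ hd v w (δ'' + 1)
  -- `u(γ v, v') ≤ M + 1` forces `u(γ v, w) ≤ δ''`
  have hkey : ∀ γ : GL (Fin 2) ℝ, pointPairInv (γ • v) v' ≤ M + 1 → pointPairInv (γ • v) w ≤ δ'' := by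
    intro γ hγ
    have h1 : dist (γ • v) v' ≤ 2 * Real.arsinh (Real.sqrt (M + 1)) := dist_le_of_pointPairInv_le hγ
    have h2 : dist (γ • v) w ≤ 2 * Real.arsinh (Real.sqrt (M + 1)) + 1 := by
      linarith [dist_triangle (γ • v) v' w]
    exact pointPairInv_le_of_dist_le h2
  rw [automorphicKernel_eq_sum hMb v v' hS (fun γ hγ => hγ.1) (fun γ hγ hlt => ⟨hγ, (hkey γ hlt.le).trans (by linarith)⟩),
    automorphicKernel_eq_sum hMb'' v w hS (fun γ hγ => hγ.1) (fun γ hγ hlt => ⟨hγ, hlt.le⟩)]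
  refine Finset.sum_le_sum fun γ _ => ?_
  by_cases hu : pointPairInv (γ • v) v' ≤ M
  · rw [ballKernel_of_le hu, ballKernel_of_le (hkey γ (by linarith))]
  · rw [ballKernel_of_gt (not_le.mp hu)]; exact ballKernel_nonneg _ _

include hΓ hneg hd hF in
/-- **`T_k G_w^δ → ½ [K_k(·, w)]` in `L²(F)` as `δ → 0⁺`**: pointwise
`(T_k G_w^δ)(v) = ½ (4πδ)⁻¹ ∫_ℍ 𝟙_{u(w,v') ≤ δ} K_k(v, v') dμ(v') → ½ K_k(v, w)` (continuity of `K_k(v, ·)`),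
dominated by `‖k‖_∞ K^{ball}_{δ''}(v, w) ∈ L²(F)`. [cite: Iwaniec2002, Thm 7.4 (proof), PDF p. 75] -/
theorem tendsto_kernelCLM_ballVec (hk : IsTestKernel k) (hkc : Continuous k) (w : ℍ) :
    Tendsto (fun δ : ℝ => kernelCLM hΓ hneg hd hF hk hkc (ballVec hΓ hneg hd hF δ w)) (𝓝[>] 0)
      (𝓝 ((1 / 2 : ℂ) • (memLp_automorphicKernel hΓ hneg hd hF hk hkc w).toLp _)) := by
  obtain ⟨_, ⟨Bk, hBk⟩, ⟨M, hM0, hM⟩⟩ := id hk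
  have hBk0 : 0 ≤ Bk := (abs_nonneg _).trans (hBk 0)
  set Kc : ℍ → ℍ → ℂ := fun v v' => (automorphicKernel Γ k v v' : ℂ) with hKc
  have hKcont : Continuous (Function.uncurry fun v v' => automorphicKernel Γ k v v') :=
    continuous_automorphicKernel₂ hΓ hd hk hkc
  set E : ℝ → ℍ → ℂ := fun δ v =>
    (((8 * π * δ)⁻¹ : ℝ) : ℂ) * (∫ v', (ballKernel δ (pointPairInv w v') : ℂ) * Kc v v') - (1 / 2 : ℂ) * Kc v w with hE
  set L := (1 / 2 : ℂ) • (memLp_automorphicKernel hΓ hneg hd hF hk hkc w).toLp _ with hL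
  rw [Lp.tendsto_Lp_iff_tendsto_eLpNorm']
  -- the `L²`-distance through `E δ`
  have hdist : ∀ δ : ℝ, 0 < δ → eLpNorm (⇑(kernelCLM hΓ hneg hd hF hk hkc (ballVec hΓ hneg hd hF δ w)) - ⇑L) 2
      (volume.restrict F) = (∫⁻ v in F, ‖E δ v‖ₑ ^ 2) ^ (1 / 2 : ℝ) := by
    intro δ hδ
    rw [eLpNorm_eq_lintegral_rpow_enorm_toReal two_ne_zero ENNReal.ofNat_ne_top]
    simp only [ENNReal.toReal_ofNat, one_div]
    congr 1
    refine lintegral_congr_ae ?_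
    filter_upwards [kernelCLM_ballVec_coeFn hΓ hneg hd hF hk hkc hδ w,
      Lp.coeFn_smul (1 / 2 : ℂ) ((memLp_automorphicKernel hΓ hneg hd hF hk hkc w).toLp _),
      (memLp_automorphicKernel hΓ hneg hd hF hk hkc w).coeFn_toLp] with v hv hv2 hv3
    rw [Pi.sub_apply, hv, hL, hv2, Pi.smul_apply, hv3, smul_eq_mul, show (2 : ℝ) = (2 : ℕ) by norm_num,
      ENNReal.rpow_natCast]
  -- measurability of `E δ`
  have hEm : ∀ δ, Measurable (E δ) := by
    intro δ
    have h1 : StronglyMeasurable (Function.uncurry fun v v' => (ballKernel δ (pointPairInv w v') : ℂ) * Kc v v') := by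
      refine Measurable.stronglyMeasurable ?_
      change Measurable fun p : ℍ × ℍ => (ballKernel δ (pointPairInv w p.2) : ℂ) * Kc p.1 p.2
      exact (Complex.measurable_ofReal.comp ((measurable_ballKernel δ).comp
        ((continuous_pointPairInv w).measurable.comp measurable_snd))).mul
        (Complex.measurable_ofReal.comp hKcont.measurable)
    have h2 : Measurable fun v => Kc v w :=
      Complex.measurable_ofReal.comp (continuous_automorphicKernel_left hΓ hd hk hkc w).measurable
    exact (measurable_const.mul h1.integral_prod_right.measurable).sub (measurable_const.mul h2)
  -- the dominating function
  set δ'' : ℝ := Real.sinh ((2 * Real.arsinh (Real.sqrt (M + 1)) + 1) / 2) ^ 2 with hδ''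
  have hδ''0 : 0 ≤ δ'' := sq_nonneg _
  set D : ℍ → ℝ≥0∞ := fun v => ENNReal.ofReal ((Bk * automorphicKernel Γ (ballKernel δ'') v w) ^ 2) with hD
  have hDfin : ∫⁻ v in F, D v ≠ ⊤ := by
    have h1 : ∫⁻ v in F, D v = ENNReal.ofReal (Bk ^ 2) * ∫⁻ v in F, ENNReal.ofReal (automorphicKernel Γ (ballKernel δ'') v w ^ 2) := by
      rw [← lintegral_const_mul' _ _ ENNReal.ofReal_ne_top]
      refine lintegral_congr fun v => ?_
      rw [hD, ← ENNReal.ofReal_mul (sq_nonneg _)]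
      simp only [mul_pow]
    rw [h1]
    refine ENNReal.mul_ne_top ENNReal.ofReal_ne_top (ne_of_lt (lt_of_le_of_lt
      (lintegral_automorphicKernel_sq_le hΓ hneg hd hF hδ''0 w) ?_))
    exact ENNReal.mul_lt_top (ENNReal.mul_lt_top (by simp) (by simp)) ENNReal.ofReal_lt_top
  -- pointwise comparison `|K_k(v, v')| ≤ Bk K''(v, w)` for `ρ(v', w) ≤ 1`
  have hcmp : ∀ v v', dist v' w ≤ 1 → ‖Kc v v'‖ ≤ Bk * automorphicKernel Γ (ballKernel δ'') v w := by
    intro v v' hv'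
    rw [hKc]
    simp only [Complex.norm_real, Real.norm_eq_abs]
    refine (abs_automorphicKernel_le_ballKernel hΓ hd hBk hM v v').trans ?_
    exact mul_le_mul_of_nonneg_left (automorphicKernel_ballKernel_le_of_dist_le hΓ hd hv' v) hBk0
  -- the pointwise bound for `δ ≤ sinh²(1/2)`
  have hbound : ∀ δ : ℝ, 0 < δ → δ ≤ Real.sinh (1 / 2) ^ 2 → ∀ v, ‖E δ v‖ₑ ^ 2 ≤ D v := by
    intro δ hδ hδ1 v
    have hkb := isTestKernel_ballKernel hδ.le
    set K'' := automorphicKernel Γ (ballKernel δ'') v w with hK''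
    have hK''0 : 0 ≤ K'' := automorphicKernel_ballKernel_nonneg hΓ hd v w
    -- on the support of the ball, `ρ(v', w) ≤ 1`
    have hsupp : ∀ v', ballKernel δ (pointPairInv w v') ≠ 0 → dist v' w ≤ 1 := by
      intro v' hv'
      rw [ballKernel_ne_zero_iff] at hv'
      have h1 := dist_le_of_pointPairInv_le hv'
      rw [dist_comm] at h1
      refine h1.trans ?_
      have h2 : Real.arsinh (Real.sqrt δ) ≤ 1 / 2 := by
        calc Real.arsinh (Real.sqrt δ) ≤ Real.arsinh (Real.sqrt (Real.sinh (1 / 2) ^ 2)) :=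
              Real.arsinh_le_arsinh.mpr (Real.sqrt_le_sqrt hδ1)
          _ = 1 / 2 := by
              rw [Real.sqrt_sq (Real.sinh_nonneg_iff.mpr (by norm_num)), Real.arsinh_sinh]
      linarith
    have hint_b : Integrable fun v' : ℍ => (ballKernel δ (pointPairInv w v') : ℂ) := by
      have := integrable_kernel_mul_of_continuous hkb (continuous_const (y := (1 : ℂ))) w
      simpa using this
    have hint_br : Integrable fun v' : ℍ => ballKernel δ (pointPairInv w v') := by
      have := hint_b.norm
      refine this.congr (Eventually.of_forall fun v' => ?_)
      simp only [Complex.norm_real, Real.norm_eq_abs, abs_of_nonneg (ballKernel_nonneg _ _)]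
    have h1 : ‖∫ v', (ballKernel δ (pointPairInv w v') : ℂ) * Kc v v'‖ ≤ (Bk * K'') * (4 * π * δ) := by
      calc ‖∫ v', (ballKernel δ (pointPairInv w v') : ℂ) * Kc v v'‖
          ≤ ∫ v', ballKernel δ (pointPairInv w v') * (Bk * K'') := by
            refine norm_integral_le_of_norm_le (hint_br.mul_const _) (Eventually.of_forall fun v' => ?_)
            rw [norm_mul, Complex.norm_real, Real.norm_eq_abs, abs_of_nonneg (ballKernel_nonneg _ _)]
            by_cases hb : ballKernel δ (pointPairInv w v') = 0
            · rw [hb]; simp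
            · exact mul_le_mul_of_nonneg_left (hcmp v v' (hsupp v' hb)) (ballKernel_nonneg _ _)
        _ = (Bk * K'') * (4 * π * δ) := by
            rw [integral_mul_const, integral_ballKernel_pointPairInv hδ.le w]; ring
    have h2 : ‖Kc v w‖ ≤ Bk * K'' := hcmp v w (by simp)
    have h3 : ‖E δ v‖ ≤ Bk * K'' := by
      rw [hE]
      simp only
      refine (norm_sub_le _ _).trans ?_
      rw [norm_mul, norm_mul, Complex.norm_real, Real.norm_eq_abs, abs_of_pos (by positivity)]
      have hδ0 : (8 * π * δ)⁻¹ * ((Bk * K'') * (4 * π * δ)) = (1 / 2) * (Bk * K'') := by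
        field_simp
        ring
      calc (8 * π * δ)⁻¹ * ‖∫ v', (ballKernel δ (pointPairInv w v') : ℂ) * Kc v v'‖ + ‖(1 / 2 : ℂ)‖ * ‖Kc v w‖
          ≤ (8 * π * δ)⁻¹ * ((Bk * K'') * (4 * π * δ)) + (1 / 2) * (Bk * K'') := by
            gcongr
            · simp
        _ = Bk * K'' := by rw [hδ0]; ring
    rw [hD]
    simp only
    rw [← ofReal_norm, ← ENNReal.ofReal_pow (norm_nonneg _)]
    exact ENNReal.ofReal_le_ofReal (pow_le_pow_left₀ (norm_nonneg _) h3 2)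
  -- pointwise convergence
  have hlim : ∀ v, Tendsto (fun δ => ‖E δ v‖ₑ ^ 2) (𝓝[>] 0) (𝓝 0) := by
    intro v
    have hKv : Continuous (Kc v) := Complex.continuous_ofReal.comp (continuous_automorphicKernel_right hΓ hd hk hkc v)
    have h1 := tendsto_invariantOperator_ballKernel_div hKv.locallyIntegrable (z := w) hKv.continuousAt
    have h2 : Tendsto (fun δ : ℝ => (1 / 2 : ℂ) * (invariantOperator (ballKernel δ) (Kc v) w / ((4 * π * δ : ℝ) : ℂ) - Kc v w))
        (𝓝[>] 0) (𝓝 ((1 / 2 : ℂ) * (Kc v w - Kc v w))) := (h1.sub_const _).const_mul _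
    rw [sub_self, mul_zero] at h2
    have h3 : Tendsto (fun δ => E δ v) (𝓝[>] 0) (𝓝 0) := by
      refine h2.congr' ?_
      filter_upwards [self_mem_nhdsWithin] with δ hδ
      have hδ' : (0 : ℝ) < δ := hδ
      rw [hE, invariantOperator_apply]
      have hπ : (π : ℂ) ≠ 0 := by exact_mod_cast Real.pi_ne_zero
      have hδ0 : (δ : ℂ) ≠ 0 := by exact_mod_cast hδ'.ne'
      push_cast
      field_simp
      ring
    have h4 : Tendsto (fun δ => ‖E δ v‖ₑ ^ 2) (𝓝[>] 0) (𝓝 (‖(0 : ℂ)‖ₑ ^ 2)) :=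
      ENNReal.Tendsto.pow ((continuous_enorm.tendsto (0 : ℂ)).comp h3)
    simpa using h4
  -- dominated convergence
  have key : Tendsto (fun δ => ∫⁻ v in F, ‖E δ v‖ₑ ^ 2) (𝓝[>] 0) (𝓝 0) := by
    have h := tendsto_lintegral_filter_of_dominated_convergence D
      (Eventually.of_forall fun δ => ((hEm δ).enorm.pow_const 2)) ?_ hDfin
      (Eventually.of_forall fun v => hlim v) (μ := volume.restrict F) (l := 𝓝[>] (0 : ℝ))
    · simpa using h
    · have hev : ∀ᶠ δ : ℝ in 𝓝[>] 0, 0 < δ ∧ δ ≤ Real.sinh (1 / 2) ^ 2 := by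
        have hpos : (0 : ℝ) < Real.sinh (1 / 2) ^ 2 := pow_pos (Real.sinh_pos_iff.mpr (by norm_num)) 2
        filter_upwards [self_mem_nhdsWithin, nhdsWithin_le_nhds (Iic_mem_nhds hpos)] with δ hδ hδ1
        exact ⟨hδ, hδ1⟩
      filter_upwards [hev] with δ hδ
      exact Eventually.of_forall (hbound δ hδ.1 hδ.2)
  have h2 := ((ENNReal.continuous_rpow_const (y := (1 / 2 : ℝ))).tendsto 0).comp key
  rw [ENNReal.zero_rpow_of_pos (by norm_num)] at h2
  refine h2.congr' ?_
  filter_upwards [self_mem_nhdsWithin] with δ hδ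
  exact (hdist δ hδ).symm

end Limits

end Literature.NumberTheory.Automorphic

end
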